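import Literature.Geometry.Kaehler.AnalyticSetProjection
import Literature.Geometry.Kaehler.AnalyticSetSingularLocus
import Literature.Geometry.Kaehler.HolomorphicChain
import HarnessLib

/-!
# Analytic subsets and their regular points under a closed linear embedding of model spaces

Layer `Literature/Geometry/Kaehler` (lane `lit-hodgefound`, Track 2 foundations, Layer A4 — the
analytic-set half of the push-forward of analytic cycle classes along the embedding of a complex
subtorus, `ComplexTorusAnalyticCycleClassSubtorusEmbedding.lean`). Let `j : K → E` be a continuous
`ℂ`-linear map between finite-dimensional complex normed spaces admitting a continuous `ℂ`-linear LEFT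
INVERSE `P : E → K` (`P ∘ j = id`; e.g. the inclusion of a complex subspace and a projection onto it), so
that `j` is a closed embedding with image `range j = {x | j (P x) = x}` and `E = range j ⊕ ker P`. For a
subset `L ⊆ K` and `y ∈ K` we compare `L` near `y` with `j(L)` near `j y`:

* §1 `IsZeroSetAt.image_of_leftInverse` / `IsZeroSetAt.of_image_of_leftInverse`: `L` is cut out by
  holomorphic equations near `y` iff `j(L)` is near `j y` (equations `g ∘ P` together with the linear
  equations `x - j (P x) = 0` of `range j`; conversely `g ∘ j`);
* §2 **`IsRegPt.image_of_leftInverse`**: if `y` is a regular point of codimension `q` of `L` then `j y`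
  is a regular point of codimension `q + (dim E - dim K)` of `j(L)` (the submersion
  `(g ∘ P, x - j (P x)) : E → ℂ^q × ker P`);
* §3 **`IsRegPt.of_image_of_leftInverse`** (the converse, `y ∈ L`): if `j y` is a regular point of
  codimension `q'` of `j(L)`, then `dim E - dim K ≤ q'` and `y` is a regular point of codimension
  `q' - (dim E - dim K)` of `L`. Proof (Chirka, §2.3: a regular point is one near which the set is a
  complex submanifold; A2.2 implicit function theorem): let `F` define `j(L)` near `a = j y` with `dF(a)`
  onto; the tangent space `K₀ = ker dF(a)` lies in `range j` (kernel comparison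
  `SCV.ker_fderiv_le_ker_fderiv_of_forall_eq` with the linear map `x ↦ x - j (P x)`, which vanishes on the
  fibre `j(L)`); choosing a complement `K₁` of `K₀' = j⁻¹ K₀` in `K` and the projection
  `ℓ = π₀ ∘ P : E → K₀'`, whose kernel `j K₁ ⊕ ker P` is a complement of `K₀`, the implicit function
  theorem in graph form (`SCV.isGraphPointOver_of_isCompl_ker`) presents `j(L)` near `a` as the graph
  `{z | s (ℓ z) = z}` of a holomorphic section `s` of `ℓ`; then `L` near `y` is the graph
  `{k | P (s (π₀ k)) = k}` of the section `P ∘ s` of `π₀ = ℓ ∘ j` (for `z = s (π₀ k)` close to `a` one has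
  `s (ℓ z) = z`, so `z ∈ j(L) ⊆ range j` and `z = j (P z)`), and a graph point is a regular point of
  codimension `dim ker π₀ = dim K₁ = dim K - dim K₀` (`SCV.IsGraphPointOver.isRegularPointOfCodim`);
* §4 manifold-level forms for the model spaces as manifolds over themselves
  (`isRegularPointOfCodim_image_iff_of_leftInverse`, **`regularLocus_image_of_leftInverse`**:
  `reg j(L) = j(reg L)`, `IsAnalyticSet.image_of_leftInverse`, **`HasPureDim.image_of_leftInverse`**:
  `j(L)` has pure dimension `d` if `L` has).

Theorems only; no definition, no named fact.

## References

* [Chirka1989] E. M. Chirka, *Complex Analytic Sets*, Kluwer (1989), §2.1 (analytic sets), §2.3 (p. 29: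
  regular points; `reg A` is locally a complex submanifold), A2.2–A2.3 (pp. 305–308: implicit function
  theorem, rank theorem). Held copy `book:chirkand-complex-analytic-sets`, chunks p0029, p0307–p0308.
* [GriffithsHarrisPrinciples1978] P. Griffiths, J. Harris, *Principles of Algebraic Geometry* (1978),
  Ch. 0 §2 (smooth points of analytic varieties).
-/

noncomputable section

open scoped Manifold Topology
open Set Function Module Filter

namespace Literature.Geometry.Kaehler

namespace SCV

open Literature.Analysis.Complex.SCV (IsZeroSetAt)

section Model

variable {K : Type*} [NormedAddCommGroup K] [NormedSpace ℂ K]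
  {E : Type*} [NormedAddCommGroup E] [NormedSpace ℂ E]
  (j : K →L[ℂ] E) (P : E →L[ℂ] K)

/-! ### §0 Elementary facts about a linear map with a continuous left inverse -/

/-- Membership in `j(L)`: `x ∈ j(L) ↔ j (P x) = x ∧ P x ∈ L` (for `P ∘ j = id`). [folklore] -/
private theorem mem_image_iff_of_leftInverse (hPj : ∀ k, P (j k) = k) {L : Set K} {x : E} :
    x ∈ j '' L ↔ j (P x) = x ∧ P x ∈ L := by
  constructor
  · rintro ⟨k, hk, rfl⟩
    exact ⟨by rw [hPj], by rwa [hPj]⟩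
  · rintro ⟨hx, hPx⟩
    exact ⟨P x, hPx, hx⟩

/-- `j⁻¹(j(L)) = L` (for `P ∘ j = id`, `j` is injective). [folklore] -/
private theorem preimage_image_of_leftInverse (hPj : ∀ k, P (j k) = k) (L : Set K) : j ⁻¹' (j '' L) = L :=
  preimage_image_eq L (LeftInverse.injective hPj)

/-- `j(L)` is closed for `L` closed: `j(L) = P⁻¹(L) ∩ {x | j (P x) = x}`. [folklore] -/
private theorem isClosed_image_of_leftInverse (hPj : ∀ k, P (j k) = k) {L : Set K} (hL : IsClosed L) :
    IsClosed (j '' L) := by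
  have h : j '' L = {x | j (P x) = x} ∩ P ⁻¹' L := by
    ext x
    rw [mem_image_iff_of_leftInverse j P hPj]
    rfl
  rw [h]
  exact (isClosed_eq (j.continuous.comp P.continuous) continuous_id).inter (hL.preimage P.continuous)

/-- `x - j (P x)` lies in `ker P`. [folklore] -/
private theorem sub_apply_mem_ker_of_leftInverse (hPj : ∀ k, P (j k) = k) (x : E) :
    x - j (P x) ∈ LinearMap.ker (P : E →ₗ[ℂ] K) := by
  rw [LinearMap.mem_ker, ContinuousLinearMap.coe_coe, map_sub, hPj, sub_self]

/-- `P` is onto (it has the right inverse `j`). [folklore] -/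
private theorem surjective_of_leftInverse (hPj : ∀ k, P (j k) = k) : Surjective P :=
  fun k ↦ ⟨j k, hPj k⟩

/-- **`dim ker P = dim E - dim K`** (`E = range j ⊕ ker P`; rank–nullity for the surjection `P`). [folklore] -/
private theorem finrank_ker_of_leftInverse [FiniteDimensional ℂ E] (hPj : ∀ k, P (j k) = k) :
    finrank ℂ (LinearMap.ker (P : E →ₗ[ℂ] K)) = finrank ℂ E - finrank ℂ K := by
  have h := LinearMap.finrank_range_add_finrank_ker (P : E →ₗ[ℂ] K)
  have hr : LinearMap.range (P : E →ₗ[ℂ] K) = ⊤ :=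
    LinearMap.range_eq_top.2 (surjective_of_leftInverse j P hPj)
  rw [hr, finrank_top] at h
  omega

/-- `dim K ≤ dim E`. [folklore] -/
private theorem finrank_le_of_leftInverse [FiniteDimensional ℂ E] (hPj : ∀ k, P (j k) = k) :
    finrank ℂ K ≤ finrank ℂ E :=
  LinearMap.finrank_le_finrank_of_injective (f := (j : K →ₗ[ℂ] E)) (LeftInverse.injective hPj)

/-- Gluing `ℂ^{m₁} × ℂ^{m₂} ≅ ℂ^{m₁ + m₂}` by two continuous linear maps `L₁`, `L₂` with
`L₁ a + L₂ b = 0 ↔ a = 0 ∧ b = 0` and `(a, b) ↦ L₁ a + L₂ b` onto. [folklore] -/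
private theorem exists_clm_glue (m₁ m₂ : ℕ) :
    ∃ (L₁ : (Fin m₁ → ℂ) →L[ℂ] (Fin (m₁ + m₂) → ℂ)) (L₂ : (Fin m₂ → ℂ) →L[ℂ] (Fin (m₁ + m₂) → ℂ)),
      (∀ a b, L₁ a + L₂ b = 0 ↔ a = 0 ∧ b = 0) ∧ ∀ w, ∃ a b, L₁ a + L₂ b = w := by
  let L : ((Fin m₁ → ℂ) × (Fin m₂ → ℂ)) ≃L[ℂ] (Fin (m₁ + m₂) → ℂ) :=
    ((LinearEquiv.sumArrowLequivProdArrow (Fin m₁) (Fin m₂) ℂ ℂ).symm ≪≫ₗ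
      LinearEquiv.funCongrLeft ℂ ℂ finSumFinEquiv.symm).toContinuousLinearEquiv
  let L' : ((Fin m₁ → ℂ) × (Fin m₂ → ℂ)) →L[ℂ] (Fin (m₁ + m₂) → ℂ) := L
  have hL : ∀ a b, L'.comp (ContinuousLinearMap.inl ℂ (Fin m₁ → ℂ) (Fin m₂ → ℂ)) a +
      L'.comp (ContinuousLinearMap.inr ℂ (Fin m₁ → ℂ) (Fin m₂ → ℂ)) b = L (a, b) := by
    intro a b
    simp only [L', ContinuousLinearMap.comp_apply, ContinuousLinearMap.inl_apply,
      ContinuousLinearMap.inr_apply, ContinuousLinearEquiv.coe_coe]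
    rw [← map_add, Prod.mk_add_mk, add_zero, zero_add]
  refine ⟨L'.comp (ContinuousLinearMap.inl ℂ (Fin m₁ → ℂ) (Fin m₂ → ℂ)),
    L'.comp (ContinuousLinearMap.inr ℂ (Fin m₁ → ℂ) (Fin m₂ → ℂ)), fun a b ↦ ?_,
    fun w ↦ ⟨(L.symm w).1, (L.symm w).2, ?_⟩⟩
  · rw [hL, ContinuousLinearEquiv.map_eq_zero_iff, Prod.mk_eq_zero]
  · rw [hL, Prod.mk.eta, ContinuousLinearEquiv.apply_symm_apply]

/-! ### §1 Zero sets of holomorphic equations -/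

/-- **`j(L)` is cut out by holomorphic equations near `j y` if `L` is near `y`**: the equations
`g ∘ P = 0` and `x - j (P x) = 0` on `P⁻¹(U)`. [cite: Chirka1989, §2.1] -/
theorem _root_.Literature.Analysis.Complex.SCV.IsZeroSetAt.image_of_leftInverse [FiniteDimensional ℂ E]
    (hPj : ∀ k, P (j k) = k) {L : Set K} {y : K} (h : IsZeroSetAt L y) :
    IsZeroSetAt (j '' L) (j y) := by
  obtain ⟨U, hU, hyU, N, g, hg, hLU⟩ := h
  set n : ℕ := finrank ℂ E with hn
  have hfin : finrank ℂ E = finrank ℂ (Fin n → ℂ) := by simp [hn]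
  set κ : E ≃L[ℂ] (Fin n → ℂ) := ContinuousLinearEquiv.ofFinrankEq hfin with hκ
  obtain ⟨L₁, L₂, hinj, -⟩ := exists_clm_glue N n
  refine ⟨P ⁻¹' U, hU.preimage P.continuous, by rw [mem_preimage, hPj]; exact hyU, N + n,
    fun x ↦ L₁ (g (P x)) + L₂ (κ (x - j (P x))), ?_, ?_⟩
  · refine (L₁.differentiable.comp_differentiableOn
      (hg.comp P.differentiableOn (mapsTo_preimage _ _))).add ?_
    exact ((L₂ : _ →L[ℂ] _).differentiable.comp ((κ : E →L[ℂ] (Fin n → ℂ)).differentiable.comp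
      (differentiable_id.sub (j.differentiable.comp P.differentiable)))).differentiableOn
  · ext x
    simp only [mem_inter_iff, mem_preimage, mem_singleton_iff]
    rw [hinj, mem_image_iff_of_leftInverse j P hPj, ContinuousLinearEquiv.map_eq_zero_iff, sub_eq_zero]
    constructor
    · rintro ⟨⟨hx, hPx⟩, hxU⟩
      exact ⟨hxU, (hLU.subset ⟨hPx, hxU⟩).2, hx.symm⟩
    · rintro ⟨hxU, hg0, hx⟩
      exact ⟨⟨hx.symm, (hLU.symm.subset ⟨hxU, hg0⟩).1⟩, hxU⟩

/-- **Conversely, `L` is cut out near `y` by the equations `g ∘ j` of `j(L)` near `j y`.**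
[cite: Chirka1989, §2.1] -/
theorem _root_.Literature.Analysis.Complex.SCV.IsZeroSetAt.of_image_of_leftInverse (hPj : ∀ k, P (j k) = k)
    {L : Set K} {y : K} (h : IsZeroSetAt (j '' L) (j y)) : IsZeroSetAt L y := by
  obtain ⟨U, hU, hyU, N, g, hg, hLU⟩ := h
  refine ⟨j ⁻¹' U, hU.preimage j.continuous, hyU, N, g ∘ j, hg.comp j.differentiableOn (mapsTo_preimage _ _), ?_⟩
  have h1 : L ∩ j ⁻¹' U = j ⁻¹' (j '' L ∩ U) := by
    rw [preimage_inter, preimage_image_of_leftInverse j P hPj]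
  rw [h1, hLU, preimage_inter]
  rfl

/-! ### §2 Regular points of `L` give regular points of `j(L)` -/

/-- **If `y` is a regular point of codimension `q` of `L ⊆ K`, then `j y` is a regular point of
codimension `q + (dim E - dim K)` of `j(L) ⊆ E`**: with `g : U → ℂ^q` the defining submersion of `L` at
`y`, the map `x ↦ (g (P x), κ (x - j (P x)))`, `κ : ker P ≅ ℂ^{dim E - dim K}`, cuts out `j(L)` on `P⁻¹(U)`
and its differential `(dg(y) ∘ P, κ ∘ (1 - j P))` at `j y` is onto (`v = j u + c`, `c ∈ ker P`).
[cite: Chirka1989, §2.3 (p. 29)] -/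
theorem IsRegPt.image_of_leftInverse [FiniteDimensional ℂ E] (hPj : ∀ k, P (j k) = k) {L : Set K}
    {q : ℕ} {y : K} (h : IsRegPt L q y) :
    IsRegPt (j '' L) (q + (finrank ℂ E - finrank ℂ K)) (j y) := by
  obtain ⟨U, hU, hyU, g, hg, hLU, hsurj⟩ := h
  set c : ℕ := finrank ℂ E - finrank ℂ K with hc
  set C : Submodule ℂ E := LinearMap.ker (P : E →ₗ[ℂ] K) with hCdef
  have hCfin : finrank ℂ C = finrank ℂ (Fin c → ℂ) := by
    rw [hCdef, finrank_ker_of_leftInverse j P hPj]; simp [hc]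
  set κ : C ≃L[ℂ] (Fin c → ℂ) := ContinuousLinearEquiv.ofFinrankEq hCfin with hκ
  -- the projection `Q x = x - j (P x)` onto `ker P`
  set Q : E →L[ℂ] C := (ContinuousLinearMap.id ℂ E - j.comp P).codRestrict C
    (fun x ↦ sub_apply_mem_ker_of_leftInverse j P hPj x) with hQ
  have hQapply : ∀ x, (Q x : E) = x - j (P x) := fun x ↦ rfl
  obtain ⟨L₁, L₂, hinj, hLsurj⟩ := exists_clm_glue q c
  have hyU' : j y ∈ P ⁻¹' U := by rw [mem_preimage, hPj]; exact hyU
  refine ⟨P ⁻¹' U, hU.preimage P.continuous, hyU', fun x ↦ L₁ (g (P x)) + L₂ (κ (Q x)), ?_, ?_, ?_⟩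
  · refine (L₁.differentiable.comp_differentiableOn
      (hg.comp P.differentiableOn (mapsTo_preimage _ _))).add ?_
    exact (L₂.differentiable.comp ((κ : C →L[ℂ] (Fin c → ℂ)).differentiable.comp Q.differentiable)).differentiableOn
  · ext x
    simp only [mem_inter_iff, mem_preimage, mem_singleton_iff]
    rw [hinj, mem_image_iff_of_leftInverse j P hPj, ContinuousLinearEquiv.map_eq_zero_iff]
    have hQ0 : Q x = 0 ↔ j (P x) = x := by
      rw [← Subtype.coe_inj, hQapply, Submodule.coe_zero, sub_eq_zero, eq_comm]
    rw [hQ0]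
    constructor
    · rintro ⟨⟨hx, hPx⟩, hxU⟩
      exact ⟨hxU, (hLU.subset ⟨hPx, hxU⟩).2, hx⟩
    · rintro ⟨hxU, hg0, hx⟩
      exact ⟨⟨hx, (hLU.symm.subset ⟨hxU, hg0⟩).1⟩, hxU⟩
  · -- the differential at `j y`
    have hgd : HasFDerivAt g (fderiv ℂ g y) (P (j y)) := by
      rw [hPj]; exact (hg.differentiableAt (hU.mem_nhds hyU)).hasFDerivAt
    have h1 : HasFDerivAt (fun x ↦ g (P x)) ((fderiv ℂ g y).comp P) (j y) := hgd.comp (j y) P.hasFDerivAt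
    have hd : HasFDerivAt (fun x ↦ L₁ (g (P x)) + L₂ (κ (Q x)))
        (L₁.comp ((fderiv ℂ g y).comp P) + L₂.comp ((κ : C →L[ℂ] (Fin c → ℂ)).comp Q)) (j y) :=
      (L₁.hasFDerivAt.comp (j y) h1).add
        (L₂.hasFDerivAt.comp (j y) ((κ : C →L[ℂ] (Fin c → ℂ)).hasFDerivAt.comp (j y) Q.hasFDerivAt))
    rw [hd.fderiv]
    intro w
    obtain ⟨a, b, hab⟩ := hLsurj w
    obtain ⟨u, hu⟩ := hsurj a
    refine ⟨j u + (κ.symm b : C), ?_⟩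
    have hP : P (j u + ((κ.symm b : C) : E)) = u := by
      have h0 : P ((κ.symm b : C) : E) = 0 := (κ.symm b).2
      rw [map_add, hPj, h0, add_zero]
    have hQv : Q (j u + ((κ.symm b : C) : E)) = κ.symm b := by
      apply Subtype.ext
      rw [hQapply, hP, add_sub_cancel_left]
    simp only [add_apply, ContinuousLinearMap.comp_apply, ContinuousLinearEquiv.coe_coe,
      hP, hu, hQv, ContinuousLinearEquiv.apply_symm_apply, hab]

/-! ### §3 Regular points of `j(L)` give regular points of `L` -/

/-- **The tangent space of `j(L)` at a regular point lies in `range j`**: if `F` cuts out `j(L)` near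
`a ∈ j(L)` with `dF(a)` onto, then every `v ∈ ker dF(a)` satisfies `v = j (P v)` (kernel comparison with
the linear map `x ↦ x - j (P x)`, constant on the fibre `j(L)`). [cite: Chirka1989, §2.3 (p. 29) and A2.2] -/
theorem apply_eq_of_mem_ker_fderiv_of_leftInverse [FiniteDimensional ℂ E] (hPj : ∀ k, P (j k) = k)
    {L : Set K} {q' : ℕ} {a : E} (haL : a ∈ j '' L) {U : Set E} (hU : IsOpen U) (haU : a ∈ U)
    {F : E → (Fin q' → ℂ)} (hF : DifferentiableOn ℂ F U) (hLU : j '' L ∩ U = U ∩ F ⁻¹' {0})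
    (hsurj : Surjective (fderiv ℂ F a)) {v : E} (hv : fderiv ℂ F a v = 0) : j (P v) = v := by
  set Gf : E → E := fun x ↦ x - j (P x) with hGf
  have hGfd : ∀ x, HasFDerivAt Gf (ContinuousLinearMap.id ℂ E - j.comp P) x := fun x ↦
    (hasFDerivAt_id x).sub ((j.comp P).hasFDerivAt)
  have hFa : F a = 0 := (hLU.subset ⟨haL, haU⟩).2
  have hfib : ∀ z ∈ U, F z = F a → Gf z = Gf a := by
    intro z hzU hz
    rw [hFa] at hz
    have hzL : z ∈ j '' L := (hLU.symm.subset ⟨hzU, hz⟩).1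
    have h1 : j (P z) = z := ((mem_image_iff_of_leftInverse j P hPj).1 hzL).1
    have h2 : j (P a) = a := ((mem_image_iff_of_leftInverse j P hPj).1 haL).1
    simp only [hGf, h1, h2, sub_self]
  have hle := ker_fderiv_le_ker_fderiv_of_forall_eq hF
    (fun x _ ↦ (hGfd x).differentiableAt.differentiableWithinAt) hU haU hsurj hfib
  have hv' : v ∈ LinearMap.ker (fderiv ℂ Gf a : E →ₗ[ℂ] E) := hle (LinearMap.mem_ker.2 hv)
  rw [LinearMap.mem_ker, (hGfd a).fderiv] at hv'
  have : v - j (P v) = 0 := hv'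
  exact (sub_eq_zero.1 this).symm

/-- **If `j y` (`y ∈ L`) is a regular point of codimension `q'` of `j(L)`, then
`dim E - dim K ≤ q'` and `y` is a regular point of codimension `q' - (dim E - dim K)` of `L`** — a
submanifold of `E` contained in the linear subspace `range j ≅ K` is a submanifold of `K` (implicit
function theorem in graph form over the projection `π₀ ∘ P` onto `j⁻¹(ker dF(j y))`; see the module
docstring). [cite: Chirka1989, §2.3 (p. 29) and A2.2–A2.3 (pp. 305–308)] -/
theorem IsRegPt.of_image_of_leftInverse [FiniteDimensional ℂ K] [FiniteDimensional ℂ E]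
    (hPj : ∀ k, P (j k) = k) {L : Set K} {q' : ℕ} {y : K} (hy : y ∈ L)
    (h : IsRegPt (j '' L) q' (j y)) :
    finrank ℂ E - finrank ℂ K ≤ q' ∧ IsRegPt L (q' - (finrank ℂ E - finrank ℂ K)) y := by
  obtain ⟨U, hU, haU, F, hF, hLU, hsurj⟩ := h
  set a : E := j y with ha
  have haL : a ∈ j '' L := mem_image_of_mem j hy
  have hjinj : Injective j := LeftInverse.injective hPj
  -- Step A: the tangent space `K₀ = ker dF(a)` lies in `range j`
  set K₀ : Submodule ℂ E := LinearMap.ker (fderiv ℂ F a : E →ₗ[ℂ] (Fin q' → ℂ)) with hK₀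
  have hK₀j : ∀ v ∈ K₀, j (P v) = v := fun v hv ↦
    apply_eq_of_mem_ker_fderiv_of_leftInverse j P hPj haL hU haU hF hLU hsurj (LinearMap.mem_ker.1 hv)
  -- its preimage `K₀' = j⁻¹ K₀` in `K`, and a complement `K₁`
  set K₀' : Submodule ℂ K := K₀.comap (j : K →ₗ[ℂ] E) with hK₀'
  have hmemK₀' : ∀ {k : K}, k ∈ K₀' ↔ j k ∈ K₀ := fun {k} ↦ Submodule.mem_comap
  have hPK₀ : ∀ v ∈ K₀, P v ∈ K₀' := fun v hv ↦ by
    rw [hmemK₀', hK₀j v hv]; exact hv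
  obtain ⟨K₁, hK⟩ := K₀'.exists_isCompl
  -- the projection `π₀ : K → K₀'` along `K₁`, and `ℓ = π₀ ∘ P`
  set π₀ : K →L[ℂ] K₀' := LinearMap.toContinuousLinearMap (K₀'.projectionOnto K₁ hK) with hπ₀
  have hπ₀apply : ∀ k : K, π₀ k = K₀'.projectionOnto K₁ hK k := fun k ↦ rfl
  have hπ₀left : ∀ w : K₀', π₀ (w : K) = w := fun w ↦ by
    rw [hπ₀apply]; exact Submodule.projectionOnto_apply_left hK w
  set ℓ : E →L[ℂ] K₀' := π₀.comp P with hℓ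
  have hℓapply : ∀ x, ℓ x = π₀ (P x) := fun x ↦ rfl
  have hℓj : ∀ w : K₀', ℓ (j (w : K)) = w := fun w ↦ by rw [hℓapply, hPj, hπ₀left]
  have hℓsurj : Surjective ℓ := fun w ↦ ⟨j (w : K), hℓj w⟩
  -- `ker ℓ` is a complement of `K₀`
  have hcompl : IsCompl K₀ (LinearMap.ker (ℓ : E →ₗ[ℂ] K₀')) := by
    refine IsCompl.of_le ?_ ?_
    · -- disjointness
      intro v hv
      obtain ⟨hv₀, hvℓ⟩ := Submodule.mem_inf.1 hv
      rw [LinearMap.mem_ker, ContinuousLinearMap.coe_coe, hℓapply] at hvℓ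
      have h1 : π₀ (P v) = ⟨P v, hPK₀ v hv₀⟩ := by
        rw [hπ₀apply]; exact Submodule.projectionOnto_apply_of_mem_left hK (hPK₀ v hv₀)
      rw [h1] at hvℓ
      have h2 : P v = 0 := congrArg Subtype.val hvℓ
      have h3 : v = 0 := by rw [← hK₀j v hv₀, h2, map_zero]
      rw [h3]; exact Submodule.zero_mem _
    · -- every `x` is `j w + (x - j w)` with `w = π₀ (P x) ∈ K₀'`
      intro x _
      set w : K₀' := π₀ (P x) with hw
      have hjw : j (w : K) ∈ K₀ := (hmemK₀'.1 w.2)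
      refine Submodule.mem_sup.2 ⟨j (w : K), hjw, x - j (w : K), ?_, add_sub_cancel _ _⟩
      rw [LinearMap.mem_ker, ContinuousLinearMap.coe_coe, map_sub, hℓj, hℓapply, ← hw, sub_self]
  -- Step C: `j(L)` is the graph of a holomorphic section `s` of `ℓ` near `a`
  haveI : CompleteSpace K₀' := FiniteDimensional.complete ℂ K₀'
  obtain ⟨V, hV, haV, V', hV', hVV', s, hs, hℓs, hAV⟩ :=
    isGraphPointOver_of_isCompl_ker (ℓ := ℓ) (A := j '' L) hU haU hF hLU haL hsurj hℓsurj hcompl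
  -- points of the graph: `s z' ∈ V` with `z' ∈ V'` implies `s z' ∈ j(L)`
  have hgraph : ∀ z' ∈ V', s z' ∈ V → s z' ∈ j '' L := by
    intro z' hz' hsV
    have : s z' ∈ j '' L ∩ V := by
      rw [hAV]; exact ⟨hsV, by rw [hℓs z' hz']⟩
    exact this.1
  -- shrink `V` so that `s (ℓ z) ∈ V`
  have hsc : ContinuousOn (fun z ↦ s (ℓ z)) V :=
    hs.continuousOn.comp ℓ.continuous.continuousOn fun z hz ↦ hVV' hz
  set V₁ : Set E := V ∩ (fun z ↦ s (ℓ z)) ⁻¹' V with hV₁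
  have hV₁o : IsOpen V₁ := hsc.isOpen_inter_preimage hV hV
  have hsa : s (ℓ a) = a := by
    have : a ∈ j '' L ∩ V := ⟨haL, haV⟩
    rw [hAV] at this; exact this.2
  have haV₁ : a ∈ V₁ := ⟨haV, by rw [mem_preimage, hsa]; exact haV⟩
  -- Step D: `L` is the graph of the section `P ∘ s` of `π₀ = ℓ ∘ j` near `y`
  set ℓ' : K →L[ℂ] K₀' := ℓ.comp j with hℓ'
  have hℓ'apply : ∀ k, ℓ' k = ℓ (j k) := fun k ↦ rfl
  have hgraph' : IsGraphPointOver ℓ' L y := by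
    refine ⟨j ⁻¹' V₁, hV₁o.preimage j.continuous, haV₁, V', hV', fun k hk ↦ hVV' hk.1, fun z' ↦ P (s z'),
      P.differentiable.comp_differentiableOn hs, fun z' hz' ↦ ?_, ?_⟩
    · show ℓ (j (P (s z'))) = z'
      rw [hℓapply, hPj, ← hℓapply, hℓs z' hz']
    · ext k
      simp only [mem_inter_iff, mem_preimage, mem_setOf_eq]
      constructor
      · rintro ⟨hkL, hkV₁⟩
        refine ⟨hkV₁, ?_⟩
        have h1 : j k ∈ j '' L ∩ V := ⟨mem_image_of_mem j hkL, hkV₁.1⟩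
        rw [hAV] at h1
        show P (s (ℓ (j k))) = k
        rw [h1.2, hPj]
      · rintro ⟨hkV₁, hk⟩
        change P (s (ℓ (j k))) = k at hk
        have hz'V' : ℓ (j k) ∈ V' := hVV' hkV₁.1
        have hzV : s (ℓ (j k)) ∈ V := hkV₁.2
        obtain ⟨k', hk'L, hk'⟩ := hgraph _ hz'V' hzV
        have : k' = k := by rw [← hPj k', hk', hk]
        rw [← this]
        exact ⟨hk'L, by rw [this]; exact hkV₁⟩
  -- Step E: a graph point is a regular point of codimension `dim ker ℓ' = dim K - dim K₀'`
  have hreg := hgraph'.isRegularPointOfCodim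
  rw [isRegularPointOfCodim_iff_isRegPt] at hreg
  -- dimension count
  have hkerℓ' : LinearMap.ker (ℓ' : K →ₗ[ℂ] K₀') = K₁ := by
    ext k
    rw [LinearMap.mem_ker, ContinuousLinearMap.coe_coe, hℓ'apply, hℓapply, hPj, hπ₀apply,
      Submodule.projectionOnto_apply_eq_zero_iff]
  have hdimK₀ : finrank ℂ K₀ + q' = finrank ℂ E := by
    have h := LinearMap.finrank_range_add_finrank_ker (fderiv ℂ F a : E →ₗ[ℂ] (Fin q' → ℂ))
    rw [LinearMap.range_eq_top.2 hsurj, finrank_top] at h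
    simp only [finrank_fintype_fun_eq_card, Fintype.card_fin] at h
    rw [hK₀]; omega
  have hdimK₀' : finrank ℂ K₀' = finrank ℂ K₀ := by
    have h1 : K₀'.map (j : K →ₗ[ℂ] E) = K₀ := by
      rw [hK₀', Submodule.map_comap_eq]
      refine inf_eq_right.2 fun v hv ↦ ⟨P v, ?_⟩
      exact hK₀j v hv
    rw [← h1]
    exact (LinearEquiv.finrank_eq (Submodule.equivMapOfInjective (j : K →ₗ[ℂ] E) hjinj K₀')).symm.symm
  have hdimK₁ : finrank ℂ K₁ + finrank ℂ K₀' = finrank ℂ K := by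
    have h := Submodule.finrank_sup_add_finrank_inf_eq K₀' K₁
    rw [hK.sup_eq_top, hK.inf_eq_bot, finrank_top, finrank_bot] at h
    omega
  have hKE : finrank ℂ K ≤ finrank ℂ E := finrank_le_of_leftInverse j P hPj
  have hK₀'le : finrank ℂ K₀' ≤ finrank ℂ K := Submodule.finrank_le K₀'
  refine ⟨by omega, ?_⟩
  have hcod : finrank ℂ (LinearMap.ker (ℓ' : K →ₗ[ℂ] K₀')) = q' - (finrank ℂ E - finrank ℂ K) := by
    rw [hkerℓ']; omega
  rwa [hcod] at hreg

/-- **Regular points correspond under `j`, with the shift of codimension `dim E - dim K`** (`y ∈ L`):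
`j y` is regular of codimension `q'` for `j(L)` iff `dim E - dim K ≤ q'` and `y` is regular of codimension
`q' - (dim E - dim K)` for `L`. [cite: Chirka1989, §2.3 (p. 29)] -/
theorem isRegPt_image_iff_of_leftInverse [FiniteDimensional ℂ K] [FiniteDimensional ℂ E]
    (hPj : ∀ k, P (j k) = k) {L : Set K} {q' : ℕ} {y : K} (hy : y ∈ L) :
    IsRegPt (j '' L) q' (j y) ↔
      finrank ℂ E - finrank ℂ K ≤ q' ∧ IsRegPt L (q' - (finrank ℂ E - finrank ℂ K)) y := by
  refine ⟨fun h ↦ h.of_image_of_leftInverse j P hPj hy, fun ⟨hle, h⟩ ↦ ?_⟩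
  have h' := h.image_of_leftInverse j P hPj
  rwa [Nat.sub_add_cancel hle] at h'

end Model

end SCV

/-! ### §4 Manifold-level statements (the model spaces as manifolds over themselves) -/

section Manifold

variable {K : Type*} [NormedAddCommGroup K] [NormedSpace ℂ K]
  {E : Type*} [NormedAddCommGroup E] [NormedSpace ℂ E]
  (j : K →L[ℂ] E) (P : E →L[ℂ] K)

/-- `j(L)` is analytic at `j y` if `L` is analytic at `y`. [cite: Chirka1989, §2.1] -/
theorem IsAnalyticSetAt.image_of_leftInverse [FiniteDimensional ℂ E] (hPj : ∀ k, P (j k) = k)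
    {L : Set K} {y : K} (h : IsAnalyticSetAt 𝓘(ℂ, K) L y) : IsAnalyticSetAt 𝓘(ℂ, E) (j '' L) (j y) :=
  Literature.Analysis.Complex.SCV.isZeroSetAt_iff_isAnalyticSetAt.1
    ((Literature.Analysis.Complex.SCV.isZeroSetAt_iff_isAnalyticSetAt.2 h).image_of_leftInverse j P hPj)

/-- `L` is analytic at `y` if `j(L)` is analytic at `j y`. [cite: Chirka1989, §2.1] -/
theorem IsAnalyticSetAt.of_image_of_leftInverse (hPj : ∀ k, P (j k) = k) {L : Set K} {y : K}
    (h : IsAnalyticSetAt 𝓘(ℂ, E) (j '' L) (j y)) : IsAnalyticSetAt 𝓘(ℂ, K) L y :=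
  Literature.Analysis.Complex.SCV.isZeroSetAt_iff_isAnalyticSetAt.1
    ((Literature.Analysis.Complex.SCV.isZeroSetAt_iff_isAnalyticSetAt.2 h).of_image_of_leftInverse j P hPj)

/-- **The image `j(L)` of an analytic subset `L ⊆ K` is an analytic subset of `E`** (analytic at the
points `j y`, `y ∈ K`, by §1, and closed, hence vacuously analytic off itself).
[cite: Chirka1989, §2.1] -/
theorem IsAnalyticSet.image_of_leftInverse [FiniteDimensional ℂ E] (hPj : ∀ k, P (j k) = k) {L : Set K}
    (h : IsAnalyticSet 𝓘(ℂ, K) L) : IsAnalyticSet 𝓘(ℂ, E) (j '' L) := by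
  have hcl : IsClosed (j '' L) := SCV.isClosed_image_of_leftInverse j P hPj h.isClosed
  intro x
  by_cases hx : x ∈ j '' L
  · obtain ⟨y, -, rfl⟩ := hx
    exact (h y).image_of_leftInverse j P hPj
  · exact IsAnalyticSetAt.of_notMem_closure (by rwa [hcl.closure_eq])

/-- **Regular points correspond under `j`** (manifold-level, `y ∈ L`): `j y` is a regular point of
codimension `q'` of `j(L)` iff `dim E - dim K ≤ q'` and `y` is a regular point of codimension
`q' - (dim E - dim K)` of `L`. [cite: Chirka1989, §2.3 (p. 29)] -/
theorem isRegularPointOfCodim_image_iff_of_leftInverse [FiniteDimensional ℂ K] [FiniteDimensional ℂ E]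
    (hPj : ∀ k, P (j k) = k) {L : Set K} {q' : ℕ} {y : K} (hy : y ∈ L) :
    IsRegularPointOfCodim 𝓘(ℂ, E) (j '' L) q' (j y) ↔
      finrank ℂ E - finrank ℂ K ≤ q' ∧
        IsRegularPointOfCodim 𝓘(ℂ, K) L (q' - (finrank ℂ E - finrank ℂ K)) y := by
  rw [SCV.isRegularPointOfCodim_iff_isRegPt, SCV.isRegularPointOfCodim_iff_isRegPt]
  exact SCV.isRegPt_image_iff_of_leftInverse j P hPj hy

/-- **`j y` is regular of codimension `q + (dim E - dim K)` for `j(L)` if `y` is regular of codimension `q`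
for `L`** (manifold-level). [cite: Chirka1989, §2.3 (p. 29)] -/
theorem IsRegularPointOfCodim.image_of_leftInverse [FiniteDimensional ℂ E] (hPj : ∀ k, P (j k) = k)
    {L : Set K} {q : ℕ} {y : K} (h : IsRegularPointOfCodim 𝓘(ℂ, K) L q y) :
    IsRegularPointOfCodim 𝓘(ℂ, E) (j '' L) (q + (finrank ℂ E - finrank ℂ K)) (j y) := by
  rw [SCV.isRegularPointOfCodim_iff_isRegPt] at h ⊢
  exact h.image_of_leftInverse j P hPj

/-- **`reg j(L) = j(reg L)`**: the regular locus of the image is the image of the regular locus.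
[cite: Chirka1989, §2.3 (p. 29)] -/
theorem regularLocus_image_of_leftInverse [FiniteDimensional ℂ K] [FiniteDimensional ℂ E]
    (hPj : ∀ k, P (j k) = k) (L : Set K) :
    regularLocus 𝓘(ℂ, E) (j '' L) = j '' regularLocus 𝓘(ℂ, K) L := by
  ext x
  constructor
  · rintro ⟨hx, q', hq'⟩
    obtain ⟨y, hy, rfl⟩ := hx
    obtain ⟨-, h⟩ := (isRegularPointOfCodim_image_iff_of_leftInverse j P hPj hy).1 hq'
    exact ⟨y, ⟨hy, _, h⟩, rfl⟩
  · rintro ⟨y, ⟨hy, q, hq⟩, rfl⟩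
    exact ⟨mem_image_of_mem j hy, _, hq.image_of_leftInverse j P hPj⟩

/-- **`j(L)` has pure dimension `d` if `L` has pure dimension `d`** (its regular points are the `j y`,
`y ∈ reg L`, of codimension `(dim K - d) + (dim E - dim K) = dim E - d`).
[cite: Chirka1989, §2.3 (p. 29)] -/
theorem HasPureDim.image_of_leftInverse [FiniteDimensional ℂ K] [FiniteDimensional ℂ E]
    (hPj : ∀ k, P (j k) = k) {L : Set K} {d : ℕ} (h : HasPureDim 𝓘(ℂ, K) L d) :
    HasPureDim 𝓘(ℂ, E) (j '' L) d := by
  obtain ⟨c, hdc, hLa, hLne, hLreg⟩ := h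
  have hKE : finrank ℂ K ≤ finrank ℂ E := SCV.finrank_le_of_leftInverse j P hPj
  refine ⟨c + (finrank ℂ E - finrank ℂ K), by omega, hLa.image_of_leftInverse j P hPj, hLne.image j,
    fun x hx ↦ ?_⟩
  rw [regularLocus_image_of_leftInverse j P hPj] at hx
  obtain ⟨y, hy, rfl⟩ := hx
  exact (hLreg y hy).image_of_leftInverse j P hPj

/-- **A point of `j(L)` regular for `j(L)` comes from a regular point of `L`**: if `x ∈ reg j(L)` then
`P x ∈ reg L` and `x = j (P x)`. [cite: Chirka1989, §2.3 (p. 29)] -/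
theorem mem_regularLocus_of_mem_regularLocus_image_of_leftInverse [FiniteDimensional ℂ K]
    [FiniteDimensional ℂ E] (hPj : ∀ k, P (j k) = k) {L : Set K} {x : E}
    (hx : x ∈ regularLocus 𝓘(ℂ, E) (j '' L)) : j (P x) = x ∧ P x ∈ regularLocus 𝓘(ℂ, K) L := by
  rw [regularLocus_image_of_leftInverse j P hPj] at hx
  obtain ⟨y, hy, rfl⟩ := hx
  rw [hPj]
  exact ⟨rfl, hy⟩

end Manifold

end Literature.Geometry.Kaehler

end
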